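import Summits.HodgeConjecture.CorCM.TwoSheetDegenerateBalanced
import Summits.HodgeConjecture.CorCM.GaloisWeightCertificateLift
import Summits.HodgeConjecture.CorCM.GaloisQuaternionCyclicLift
import Mathlib.GroupTheory.SpecificGroups.Quaternion
import Mathlib.Analysis.SpecialFunctions.Complex.Circle
import HarnessLib

/-!
# THE TWO-SHEET FORMAT FOR ARBITRARY FIBRES on `Q_{4m} × C_p`: convolution counts constant along `ℤ/p` ⟹ BAD

COR-CM (cell `pub-hodgecm2`), binder seat b04 (gen 42), count-neutral own lane «Galois-CM-type classification» (blanket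
`CorCM/Galois*`).  KERNEL ONLY: theorems; no definition, no named fact, no `sorry`.  `HC_CM` is neither used nor claimed.

SETTING.  `H₀ = Q_{4m} × C_p = QuaternionGroup m × Multiplicative (ZMod p)` (`p` an odd prime), `c₁ = (aᵐ, 1)`, abelian subgroup
`A = ⟨a⟩ × C_p ≅ ℤ/2m × ℤ/p` of index two (`x = (xa 0, 1)`).  A set `T₁ ⊆ H₀` is given by ARBITRARY fibres: Boolean indicators
`Ju j v` (is `(aʲ, v) ∈ T₁`?) and `Jv j v` (is `(x aʲ, v) ∈ T₁`?), `j ∈ ℤ/2m`, `v ∈ ℤ/p`.  At the odd character `χ₀ = (ζ_{2m}, ξ)` of `A`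
the two-sheet block of `T₁` is `Ŝ₁Ŝ₁^θ + Ŝ₂Ŝ₂^θ = Σ_{d ∈ ℤ/2m} ζᵈ Σ_{s ∈ ℤ/p} ξˢ F_d(s)` with the CONVOLUTION COUNTS
`F_d(s) = Σ_{j} #{v : v ∈ J_{j+d}, s − v ∈ J_j} + (second sheet)`; so if every `F_d` is CONSTANT along `ℤ/p` (`Σ_s ξˢ = 0`) the block is
singular, and the two-sheet degeneracy lemma with balance (`CorCM/TwoSheetDegenerateBalanced`) gives a non-zero `c₁`-antisymmetric rational
weight annihilated by the right translates of `T₁` and balanced over `C_p`; the weight lift (`CorCM/GaloisWeightCertificateLift`) dresses it: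
`Q_{4m} × C_p ↪ Gal(K/ℚ)` through `c` with `C_p` normal + such a `T₁` (CM, trivial left stabiliser) ⟹ BAD.  This generalises the
Gauss-alphabet norm format of gen 41 (`CorCM/GaloisQuaternionCyclicTwoSheetNorm(Lift)`: fibres unions of `{0}`, squares, non-squares,
`p ≡ 3 (mod 4)`) to ALL fibres and all odd `p`: the per-instance identity is `2m·p` natural-number equalities (a `decide`), and fibres
that are unions of cosets of ANY subgroup of `𝔽_pˣ` (period alphabets: sextic, quartic, octic letters) or arbitrary subsets become
certificates — e.g. `Q₁₆ × C₃₁` (sextic letters; `ord₃₁ 2` odd, so `Q₈ × C₃₁` is GOOD).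

* §1 `fibreSum_mul_fibreSum` — product of two fibre sums as a character sum of convolution counts.
* §2 **`exists_balanced_annihilator_of_twoSheet_sets`** — the model theorem.
* §3 **`exists_simple_degenerate_of_quaternion_cyclic_sets`** — the Galois dress.

## References

* [Kubota1965] T. Kubota, Trans. AMS 118 (1965), §4 Lemma 2.  [Dodson1984] B. Dodson, Trans. AMS 283 (1984), §3.1.1, §5.3.
* [Shimura1998] G. Shimura, *Abelian Varieties with Complex Multiplication and Modular Functions*, §6.2 Thm. 3, §8.2 Prop. 26.
* [Gordon1999HodgeAVSurvey] B. B. Gordon, *A survey of the Hodge conjecture for abelian varieties*, Thm. 6.4, §9.3, Prop. 9.4.1.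
-/

noncomputable section

open scoped BigOperators

namespace Summit.HodgeConjecture.CorCM.GaloisQuaternionCyclic

open QuaternionGroup AddChar

/-! ## §1 Products of fibre sums -/

/-- For an additive character `ψ` of `ℤ/p` and Boolean fibres `J₁, J₂ ⊆ ℤ/p`:
`(Σ_{v ∈ J₁} ψ v)(Σ_{w ∈ J₂} ψ w) = Σ_s ψ(s) · #{v ∈ J₁ : s − v ∈ J₂}` (convolution counts). [folklore] -/
theorem fibreSum_mul_fibreSum {p : ℕ} [NeZero p] (ψ : AddChar (ZMod p) ℂ) (J₁ J₂ : ZMod p → Bool) :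
    (∑ v : ZMod p, if J₁ v = true then ψ v else 0) * (∑ w : ZMod p, if J₂ w = true then ψ w else 0) =
      ∑ s : ZMod p, ψ s * ∑ v : ZMod p, ((J₁ v && J₂ (s - v)).toNat : ℂ) := by
  classical
  rw [Finset.sum_mul_sum]
  have hv : ∀ v : ZMod p, ∑ w : ZMod p, (if J₁ v = true then ψ v else 0) * (if J₂ w = true then ψ w else 0) =
      ∑ s : ZMod p, ψ s * ((J₁ v && J₂ (s - v)).toNat : ℂ) := fun v => by
    refine Fintype.sum_equiv (Equiv.addLeft v) _ _ fun w => ?_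
    simp only [Equiv.coe_addLeft, add_sub_cancel_left]
    have hψ : ψ (v + w) = ψ v * ψ w := map_add_eq_mul ψ v w
    cases J₁ v <;> cases J₂ w <;> simp [hψ]
  simp_rw [hv]
  rw [Finset.sum_comm]
  refine Finset.sum_congr rfl fun s _ => ?_
  rw [Finset.mul_sum]

/-! ## §2 The model theorem -/

/-- **THE TWO-SHEET FORMAT FOR ARBITRARY FIBRES (model theorem).**  `H₀ = Q_{4m} × C_p` (`p` prime), `T₁ ⊆ H₀` with fibres
`Ju j = {v : (aʲ, v) ∈ T₁}`, `Jv j = {v : (x aʲ, v) ∈ T₁}` (`j ∈ ℤ/2m`, Boolean indicators).  If for every `d ∈ ℤ/2m` the convolution count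
`s ↦ Σ_j #{v : v ∈ Ju (j+d), s − v ∈ Ju j} + Σ_j #{v : v ∈ Jv (j+d), s − v ∈ Jv j}` is CONSTANT (`= c d`) along `ℤ/p`, then there is a
non-zero `(aᵐ, 1)`-antisymmetric `b₁ : H₀ → ℚ` annihilated by all right translates of `T₁` and BALANCED OVER `C_p`
(`Σ_v b₁(g·(1, v)) = 0`).  (No CM or parity hypothesis is needed here; they enter in the Galois dress.)
[cite: Kubota1965, §4 Lemma 2] [cite: Dodson1984, §5.3] [cite: Gordon1999HodgeAVSurvey, Prop. 9.4.1] -/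
theorem exists_balanced_annihilator_of_twoSheet_sets {m p : ℕ} [NeZero m] [hp : Fact p.Prime]
    (Ju Jv : ZMod (2 * m) → ZMod p → Bool) (T₁ : Finset (QuaternionGroup m × Multiplicative (ZMod p)))
    (hTa : ∀ (j : ZMod (2 * m)) (v : ZMod p),
      ((a j, Multiplicative.ofAdd v) : QuaternionGroup m × Multiplicative (ZMod p)) ∈ T₁ ↔ Ju j v = true)
    (hTx : ∀ (j : ZMod (2 * m)) (v : ZMod p),
      ((xa j, Multiplicative.ofAdd v) : QuaternionGroup m × Multiplicative (ZMod p)) ∈ T₁ ↔ Jv j v = true)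
    (c : ZMod (2 * m) → ℕ)
    (hF : ∀ (d : ZMod (2 * m)) (s : ZMod p), ∑ j : ZMod (2 * m), ∑ v : ZMod p,
      ((Ju (j + d) v && Ju j (s - v)).toNat + (Jv (j + d) v && Jv j (s - v)).toNat) = c d) :
    ∃ b₁ : QuaternionGroup m × Multiplicative (ZMod p) → ℚ, (∃ y, b₁ y ≠ 0) ∧
      (∀ g, b₁ (((a m, 1) : QuaternionGroup m × Multiplicative (ZMod p)) * g) = -b₁ g) ∧
      (∀ g, ∑ s ∈ T₁, b₁ (s * g) = 0) ∧
      ∀ g, ∑ v : ZMod p, b₁ (g * (1, Multiplicative.ofAdd v)) = 0 := by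
  classical
  have hpr : p.Prime := hp.out
  haveI : NeZero p := ⟨hpr.ne_zero⟩
  have hm0 : m ≠ 0 := NeZero.ne m
  -- (a) the two-sheet structure of `Q_{4m} × C_p`: `A = ⟨a⟩ × C_p ≅ ℤ/2m × ℤ/p`, `x = (xa 0, 1)`
  let i₁ : Multiplicative (ZMod (2 * m)) →* QuaternionGroup m :=
    MonoidHom.mk' (fun u => a (Multiplicative.toAdd u)) fun u v => by simp [toAdd_mul]
  let i : Multiplicative (ZMod (2 * m)) × Multiplicative (ZMod p) →* QuaternionGroup m × Multiplicative (ZMod p) :=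
    MonoidHom.prodMap i₁ (MonoidHom.id _)
  have hi_apply : ∀ u v, i (u, v) = (a (Multiplicative.toAdd u), v) := fun u v => rfl
  have hi : Function.Injective i := by
    rintro ⟨u, v⟩ ⟨u', v'⟩ h
    simp only [hi_apply, Prod.mk.injEq, a.injEq] at h
    exact Prod.ext (by simpa using h.1) h.2
  have hx : ∀ w, i w ≠ (xa 0, 1) := fun ⟨u, v⟩ => by simp [hi_apply]
  have hcov : ∀ g : QuaternionGroup m × Multiplicative (ZMod p), (∃ w, g = i w) ∨ (∃ w, g = i w * (xa 0, 1)) := by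
    rintro ⟨j | j, v⟩
    · exact Or.inl ⟨(Multiplicative.ofAdd j, v), by simp [hi_apply]⟩
    · exact Or.inr ⟨(Multiplicative.ofAdd (-j), v), by simp [hi_apply]⟩
  let θ : Multiplicative (ZMod (2 * m)) × Multiplicative (ZMod p) ≃*
      Multiplicative (ZMod (2 * m)) × Multiplicative (ZMod p) :=
    MulEquiv.prodCongr (MulEquiv.inv _) (MulEquiv.refl _)
  have hθ_apply : ∀ w, θ w = (w.1⁻¹, w.2) := fun w => rfl
  have hθ : ∀ w, ((xa 0, 1) : QuaternionGroup m × Multiplicative (ZMod p)) * i w = i (θ w) * (xa 0, 1) :=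
    fun ⟨u, v⟩ => by simp [hi_apply, hθ_apply]
  set c₀ : Multiplicative (ZMod (2 * m)) × Multiplicative (ZMod p) := (Multiplicative.ofAdd (m : ZMod (2 * m)), 1) with hc_def
  have hic : i c₀ = (a m, 1) := rfl
  have h2m : (m : ZMod (2 * m)) + m = 0 := by
    rw [← Nat.cast_add, show m + m = 2 * m by ring, ZMod.natCast_self]
  have hxx : ((xa 0, 1) : QuaternionGroup m × Multiplicative (ZMod p)) * (xa 0, 1) = i c₀ := by
    rw [hic, Prod.mk_mul_mk, xa_mul_xa, mul_one]
    norm_num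
  have hθc : θ c₀ = c₀ := by
    rw [hθ_apply, hc_def]
    refine Prod.ext ?_ rfl
    change Multiplicative.ofAdd (-(m : ZMod (2 * m))) = Multiplicative.ofAdd (m : ZMod (2 * m))
    rw [neg_eq_of_add_eq_zero_left h2m]
  -- the two sheets of `T₁`
  set S₁ : Finset (Multiplicative (ZMod (2 * m)) × Multiplicative (ZMod p)) :=
    Finset.univ.filter fun w => i w ∈ T₁ with hS₁_def
  set S₂ : Finset (Multiplicative (ZMod (2 * m)) × Multiplicative (ZMod p)) :=
    Finset.univ.filter fun w => i w * (xa 0, 1) ∈ T₁ with hS₂_def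
  have hS₁ : ∀ w, w ∈ S₁ ↔ i w ∈ T₁ := fun w => by simp [hS₁_def]
  have hS₂ : ∀ w, w ∈ S₂ ↔ i w * (xa 0, 1) ∈ T₁ := fun w => by simp [hS₂_def]
  -- (b) the odd character `χ₀(j, v) = ζʲ ξᵛ`, `ζ` a primitive `2m`-th and `ξ` a primitive `p`-th root of unity
  have hζ : IsPrimitiveRoot (Complex.exp (2 * Real.pi * Complex.I / (2 * m : ℕ))) (2 * m) :=
    Complex.isPrimitiveRoot_exp (2 * m) (by positivity)
  have hξ : IsPrimitiveRoot (Complex.exp (2 * Real.pi * Complex.I / p)) p := Complex.isPrimitiveRoot_exp p hpr.ne_zero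
  set ψ₂ : AddChar (ZMod (2 * m)) ℂ := zmodChar (2 * m) hζ.pow_eq_one with hψ₂_def
  set ψp : AddChar (ZMod p) ℂ := zmodChar p hξ.pow_eq_one with hψp_def
  have hψp1 : ψp ≠ 1 := by
    intro h
    have h1 : ψp 1 = 1 := by rw [h, AddChar.one_apply]
    rw [hψp_def, zmodChar_apply, ZMod.val_one, pow_one] at h1
    exact hξ.ne_one hpr.one_lt h1
  have hsumψ : ∑ v : ZMod p, ψp v = 0 := AddChar.sum_eq_zero_of_ne_one hψp1
  have hψ₂m : ψ₂ (m : ZMod (2 * m)) = -1 := by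
    have hval : ((m : ℕ) : ZMod (2 * m)).val = m := by
      rw [ZMod.val_natCast]; exact Nat.mod_eq_of_lt (by omega)
    rw [hψ₂_def, zmodChar_apply, hval]
    have hne : Complex.exp (2 * Real.pi * Complex.I / (2 * m : ℕ)) ^ m ≠ 1 :=
      hζ.pow_ne_one_of_pos_of_lt (by omega) (by omega)
    have hsq : Complex.exp (2 * Real.pi * Complex.I / (2 * m : ℕ)) ^ m * Complex.exp (2 * Real.pi * Complex.I / (2 * m : ℕ)) ^ m = 1 := by
      rw [← pow_add, show m + m = 2 * m by ring, hζ.pow_eq_one]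
    rcases mul_self_eq_one_iff.mp hsq with h | h
    · exact absurd h hne
    · exact h
  let χ₀ : AddChar (Additive (Multiplicative (ZMod (2 * m)) × Multiplicative (ZMod p))) ℂ :=
    { toFun := fun w => ψ₂ (Multiplicative.toAdd (Additive.toMul w).1) * ψp (Multiplicative.toAdd (Additive.toMul w).2)
      map_zero_eq_one' := by simp
      map_add_eq_mul' := fun w w' => by
        simp only [toMul_add, Prod.fst_mul, Prod.snd_mul, toAdd_mul, map_add_eq_mul]; ring }
  have hχ₀ : ∀ (t : Multiplicative (ZMod (2 * m))) (y : Multiplicative (ZMod p)),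
      χ₀ (Additive.ofMul (t, y)) = ψ₂ (Multiplicative.toAdd t) * ψp (Multiplicative.toAdd y) := fun t y => rfl
  have hχc : χ₀ (Additive.ofMul c₀) = -1 := by
    rw [hc_def, hχ₀, toAdd_ofAdd, toAdd_one, hψ₂m, map_zero_eq_one, mul_one]
  -- the subgroup `C_p ⊆ A` as a finset, on which `χ₀` sums to zero
  let emb : ZMod p ↪ Multiplicative (ZMod (2 * m)) × Multiplicative (ZMod p) :=
    ⟨fun v => (1, Multiplicative.ofAdd v), fun v w h => by simpa using congrArg Prod.snd h⟩
  set N : Finset (Multiplicative (ZMod (2 * m)) × Multiplicative (ZMod p)) := Finset.univ.map emb with hN_def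
  have hNsum : ∀ f : Multiplicative (ZMod (2 * m)) × Multiplicative (ZMod p) → ℂ,
      ∑ n ∈ N, f n = ∑ v : ZMod p, f (1, Multiplicative.ofAdd v) := fun f => by rw [hN_def, Finset.sum_map]; rfl
  have hNsumQ : ∀ f : Multiplicative (ZMod (2 * m)) × Multiplicative (ZMod p) → ℚ,
      ∑ n ∈ N, f n = ∑ v : ZMod p, f (1, Multiplicative.ofAdd v) := fun f => by rw [hN_def, Finset.sum_map]; rfl
  have hN : ∑ n ∈ N, χ₀ (Additive.ofMul n) = 0 := by
    rw [hNsum]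
    simp only [hχ₀, toAdd_one, toAdd_ofAdd, map_zero_eq_one, one_mul]
    exact hsumψ
  -- (c) the fibre sums `Lu j = Σ_{v ∈ Ju j} ξᵛ`, `Lv j = Σ_{v ∈ Jv j} ξᵛ`
  set Lu : ZMod (2 * m) → ℂ := fun j => ∑ v : ZMod p, if Ju j v = true then ψp v else 0 with hLu
  set Lv : ZMod (2 * m) → ℂ := fun j => ∑ v : ZMod p, if Jv j v = true then ψp v else 0 with hLv
  have hLu_eq : ∀ j, ∑ v : ZMod p, (if ((a j, Multiplicative.ofAdd v) : QuaternionGroup m × Multiplicative (ZMod p)) ∈ T₁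
      then ψp v else 0) = Lu j := fun j =>
    Finset.sum_congr rfl fun v _ => ite_congr (propext (hTa j v)) (fun _ => rfl) (fun _ => rfl)
  have hLv_eq : ∀ j, ∑ v : ZMod p, (if ((xa j, Multiplicative.ofAdd v) : QuaternionGroup m × Multiplicative (ZMod p)) ∈ T₁
      then ψp v else 0) = Lv j := fun j =>
    Finset.sum_congr rfl fun v _ => ite_congr (propext (hTx j v)) (fun _ => rfl) (fun _ => rfl)
  -- (d) the four sheet sums
  have hsumA : ∀ f : Multiplicative (ZMod (2 * m)) × Multiplicative (ZMod p) → ℂ,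
      ∑ w, f w = ∑ j : ZMod (2 * m), ∑ v : ZMod p, f (Multiplicative.ofAdd j, Multiplicative.ofAdd v) := fun f => by
    rw [Fintype.sum_prod_type]
    exact Fintype.sum_equiv Multiplicative.toAdd _ _ fun t => Fintype.sum_equiv Multiplicative.toAdd _ _ fun y => by simp
  have eS₁ : ∑ s ∈ S₁, χ₀ (Additive.ofMul s) = ∑ j : ZMod (2 * m), ψ₂ j * Lu j := by
    rw [hS₁_def, Finset.sum_filter, hsumA]
    refine Finset.sum_congr rfl fun j _ => ?_
    rw [← hLu_eq j, Finset.mul_sum]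
    refine Finset.sum_congr rfl fun v _ => ?_
    simp only [hi_apply, toAdd_ofAdd, hχ₀]
    split_ifs <;> simp
  have eS₁θ : ∑ s ∈ S₁, χ₀ (Additive.ofMul (θ s)) = ∑ j : ZMod (2 * m), ψ₂ (-j) * Lu j := by
    rw [hS₁_def, Finset.sum_filter, hsumA]
    refine Finset.sum_congr rfl fun j _ => ?_
    rw [← hLu_eq j, Finset.mul_sum]
    refine Finset.sum_congr rfl fun v _ => ?_
    simp only [hi_apply, toAdd_ofAdd, hθ_apply, hχ₀, toAdd_inv]
    split_ifs <;> simp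
  have hxmem : ∀ (j : ZMod (2 * m)) (y : Multiplicative (ZMod p)),
      ((a j, y) : QuaternionGroup m × Multiplicative (ZMod p)) * (xa 0, 1) = (xa (-j), y) := fun j y => by
    rw [Prod.mk_mul_mk, a_mul_xa, zero_sub, mul_one]
  have eS₂ : ∑ t ∈ S₂, χ₀ (Additive.ofMul t) = ∑ j : ZMod (2 * m), ψ₂ (-j) * Lv j := by
    rw [hS₂_def, Finset.sum_filter, hsumA]
    refine Fintype.sum_equiv (Equiv.neg _) _ _ fun j => ?_
    rw [Equiv.neg_apply, neg_neg, ← hLv_eq (-j), Finset.mul_sum]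
    refine Finset.sum_congr rfl fun v _ => ?_
    simp only [hi_apply, toAdd_ofAdd, hxmem, hχ₀]
    split_ifs <;> simp
  have eS₂θ : ∑ t ∈ S₂, χ₀ (Additive.ofMul (θ t)) = ∑ j : ZMod (2 * m), ψ₂ j * Lv j := by
    rw [hS₂_def, Finset.sum_filter, hsumA]
    refine Fintype.sum_equiv (Equiv.neg _) _ _ fun j => ?_
    rw [Equiv.neg_apply, ← hLv_eq (-j), Finset.mul_sum]
    refine Finset.sum_congr rfl fun v _ => ?_
    simp only [hi_apply, toAdd_ofAdd, hxmem, hθ_apply, hχ₀, toAdd_inv]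
    split_ifs <;> simp
  -- (e) products of sheet sums as character sums of autocorrelations
  have hprod : ∀ L : ZMod (2 * m) → ℂ, (∑ j : ZMod (2 * m), ψ₂ j * L j) * (∑ k : ZMod (2 * m), ψ₂ (-k) * L k) =
      ∑ d : ZMod (2 * m), ψ₂ d * ∑ k : ZMod (2 * m), L (k + d) * L k := fun L => by
    rw [Finset.sum_mul_sum, Finset.sum_comm]
    have e1 : ∀ k : ZMod (2 * m), ∑ j : ZMod (2 * m), ψ₂ j * L j * (ψ₂ (-k) * L k) =
        ∑ d : ZMod (2 * m), ψ₂ d * (L (k + d) * L k) := fun k => by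
      symm
      refine Fintype.sum_equiv (Equiv.addLeft k) _ _ fun d => ?_
      simp only [Equiv.coe_addLeft]
      have : ψ₂ (k + d) * ψ₂ (-k) = ψ₂ d := by rw [← map_add_eq_mul]; congr 1; ring
      rw [← this]; ring
    simp_rw [e1]
    rw [Finset.sum_comm]
    refine Finset.sum_congr rfl fun d _ => ?_
    rw [Finset.mul_sum]
  -- (f) the autocorrelations vanish: `Σ_k (Lu(k+d) Lu(k) + Lv(k+d) Lv(k)) = Σ_s ξˢ · F_d(s) = c_d · Σ_s ξˢ = 0`
  have hE : ∀ d : ZMod (2 * m), ∑ k : ZMod (2 * m), (Lu (k + d) * Lu k + Lv (k + d) * Lv k) = 0 := by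
    intro d
    have hF' : ∀ s : ZMod p, ∑ k : ZMod (2 * m), ∑ v : ZMod p,
        (((Ju (k + d) v && Ju k (s - v)).toNat : ℂ) + ((Jv (k + d) v && Jv k (s - v)).toNat : ℂ)) = (c d : ℂ) := fun s => by
      have h := congrArg (Nat.cast : ℕ → ℂ) (hF d s)
      push_cast at h
      exact h
    calc ∑ k : ZMod (2 * m), (Lu (k + d) * Lu k + Lv (k + d) * Lv k)
        = ∑ k : ZMod (2 * m), ∑ s : ZMod p, ψp s * ∑ v : ZMod p,
            (((Ju (k + d) v && Ju k (s - v)).toNat : ℂ) + ((Jv (k + d) v && Jv k (s - v)).toNat : ℂ)) := by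
          refine Finset.sum_congr rfl fun k _ => ?_
          rw [hLu, hLv, fibreSum_mul_fibreSum, fibreSum_mul_fibreSum, ← Finset.sum_add_distrib]
          refine Finset.sum_congr rfl fun s _ => ?_
          rw [← mul_add, ← Finset.sum_add_distrib]
      _ = ∑ s : ZMod p, ψp s * (c d : ℂ) := by
          rw [Finset.sum_comm]
          refine Finset.sum_congr rfl fun s _ => ?_
          rw [← Finset.mul_sum, ← hF' s, Finset.sum_comm]
      _ = 0 := by rw [← Finset.sum_mul, hsumψ, zero_mul]
  -- (g) the two-sheet block of `T₁` at `χ₀` is singular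
  have hΔ : (∑ s ∈ S₁, χ₀ (Additive.ofMul s)) * (∑ s ∈ S₁, χ₀ (Additive.ofMul (θ s))) -
      χ₀ (Additive.ofMul c₀) * ((∑ t ∈ S₂, χ₀ (Additive.ofMul t)) * (∑ t ∈ S₂, χ₀ (Additive.ofMul (θ t)))) = 0 := by
    rw [eS₁, eS₁θ, eS₂, eS₂θ, hχc, hprod Lu, mul_comm (∑ j : ZMod (2 * m), ψ₂ (-j) * Lv j), hprod Lv]
    rw [show ∀ x y : ℂ, x - (-1) * y = x + y from fun x y => by ring, ← Finset.sum_add_distrib]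
    refine Finset.sum_eq_zero fun d _ => ?_
    rw [← mul_add, ← Finset.sum_add_distrib, hE d, mul_zero]
  -- (h) the balanced annihilator
  obtain ⟨b, hb0, hanti, hann, hbal⟩ := TwoSheet.exists_annihilator_of_det_eq_zero_balanced i hi (xa 0, 1) hx hcov θ hθ c₀ hxx
    hθc T₁ S₁ S₂ hS₁ hS₂ χ₀ hχc hΔ N hN
  refine ⟨b, Function.ne_iff.mp hb0, fun g => ?_, hann, fun g => ?_⟩
  · rw [← hic]; exact hanti g
  · have h := hbal g
    rw [hNsumQ] at h
    simpa only [hi_apply, toAdd_one, ← one_def] using h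

end Summit.HodgeConjecture.CorCM.GaloisQuaternionCyclic

/-! ## §3 The Galois dress -/

namespace Summit.HodgeConjecture.CorCM.GaloisModels

open CategoryTheory CategoryTheory.Limits NumberField
open Literature.NumberTheory.ComplexMultiplication
open Literature.AlgebraicGeometry.Motives (AbelianVariety CMType)
open Literature.AlgebraicGeometry.HodgeTheory
open Literature.AlgebraicGeometry.ComplexMultiplication (IsCMTypeRealisation)
open Literature.AlgebraicGeometry.Pohlmann1968
open Literature.Barriers.HodgeConjecture (divisorClassesSpan)
open Summit.HodgeConjecture.CorCM.GaloisRank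
open Summit.HodgeConjecture.CorCM.GaloisQuaternionCyclic (exists_balanced_annihilator_of_twoSheet_sets)
open QuaternionGroup

variable {K : Type} [Field K] [NumberField K] [IsCMField K]

/-- **`Q_{4m} × C_p ↪ Gal(K/ℚ)` THROUGH `c` WITH `C_p` NORMAL + A TWO-SHEET SET WITH CONSTANT CONVOLUTION COUNTS ⟹ BAD.**
`A, X, u ∈ Gal(K/ℚ)` with `ord A = 2m`, `X² = Aᵐ = c`, `XAX⁻¹ = A⁻¹`, `ord u = p`, `[A,u] = [X,u] = 1`, `⟨u⟩ ◁ Gal`, `m ≥ 2`, `gcd(4m,p) = 1`,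
`p` prime; a set `T₁ = {P}` on `Q_{4m} × C_p` with arbitrary fibres `Ju j`, `Jv j ⊆ ℤ/p` over `aʲ`, `x aʲ` (`hPa`, `hPx`), which is a CM set
for `(aᵐ, 1)` with trivial left stabiliser, and whose convolution counts `s ↦ Σ_j #{v ∈ Ju (j+d) : s − v ∈ Ju j} + Σ_j #{v ∈ Jv (j+d) :
s − v ∈ Jv j}` are constant along `ℤ/p` for every `d ∈ ℤ/2m` (`hF`).  Then `K` carries a primitive DEGENERATE CM type: a simple CM abelian
variety of dimension `[K:ℚ]/2` with a rational `(p,p)` class outside the divisor ring on some power.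
[cite: Shimura1998, §6.2 Thm. 3 and §8.2 Prop. 26] [cite: Gordon1999HodgeAVSurvey, Thm. 6.4 and §9.3] [cite: Kubota1965, §4 Lemma 2] -/
theorem exists_simple_degenerate_of_quaternion_cyclic_sets [IsGalois ℚ K] {m p : ℕ} [NeZero m] [Fact p.Prime]
    (hm : 2 ≤ m) (hcop : Nat.Coprime (4 * m) p) {A X u : K ≃ₐ[ℚ] K} (hA : orderOf A = 2 * m)
    (hX : X * X = A ^ m) (hXA : X * A * X⁻¹ = A⁻¹) (hc : A ^ m = (IsCMField.complexConj K).restrictScalars ℚ)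
    (hu : orderOf u = p) (hAu : A * u = u * A) (hXu : X * u = u * X) (hnorm : (Subgroup.zpowers u).Normal)
    (Ju Jv : ZMod (2 * m) → ZMod p → Bool)
    (P : QuaternionGroup m × Multiplicative (ZMod p) → Prop) [DecidablePred P]
    (hPa : ∀ (j : ZMod (2 * m)) (v : ZMod p), P (a j, Multiplicative.ofAdd v) ↔ Ju j v = true)
    (hPx : ∀ (j : ZMod (2 * m)) (v : ZMod p), P (xa j, Multiplicative.ofAdd v) ↔ Jv j v = true)
    (hcm₁ : ∀ x, P x ↔ ¬ P (((a m, 1) : QuaternionGroup m × Multiplicative (ZMod p)) * x))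
    (hprim₁ : ∀ v : QuaternionGroup m × Multiplicative (ZMod p), v ≠ 1 → ∃ w, ¬ (P w ↔ P (v * w)))
    (c : ZMod (2 * m) → ℕ)
    (hF : ∀ (d : ZMod (2 * m)) (s : ZMod p), ∑ j : ZMod (2 * m), ∑ v : ZMod p,
      ((Ju (j + d) v && Ju j (s - v)).toNat + (Jv (j + d) v && Jv j (s - v)).toNat) = c d) :
    ∃ (Φ : CMType K) (φ₀ : K →+* ℂ) (A : AbelianVariety ℂ) (ι : 𝓞 K →+* End A)
      (θ : K →+* Module.End ℂ (complexBetti A.X 1)),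
      IsPrimitive (ℂ ≃+* ℂ) Φ.1 φ₀ ∧ ¬ IsNondegenerate Φ ∧ IsCMTypeRealisation Φ A ι θ ∧ A.IsSimple ∧
      A.dim = Module.finrank ℚ K / 2 ∧
      ∃ n p : ℕ, ∃ x : complexBetti (⨁ fun _ : Fin n => A).X (2 * p), IsRationalClass x ∧
        IsOfHodgeType (⨁ fun _ : Fin n => A).dim (⨁ fun _ : Fin n => A).X (2 * p) p p x ∧
        x ∉ divisorClassesSpan (⨁ fun _ : Fin n => A).X (⨁ fun _ : Fin n => A).dim p := by
  classical
  have hpr : p.Prime := Fact.out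
  haveI : NeZero p := ⟨hpr.ne_zero⟩
  have hp2 : p ≠ 2 := by
    rintro rfl
    have h := Nat.Coprime.coprime_mul_right_right (k := 2 * m) (m := 2) (n := 2) (by simpa [show 4 * m = 2 * (2 * m) by ring] using hcop)
    norm_num at h
  -- the set as a finset and its balanced annihilator (model theorem)
  set T₁ : Finset (QuaternionGroup m × Multiplicative (ZMod p)) := Finset.univ.filter P with hT₁_def
  have hT₁ : ∀ x, x ∈ T₁ ↔ P x := fun x => by simp [hT₁_def]
  obtain ⟨b₁, hb₁, hanti₁, hann₁, hbal₁⟩ := exists_balanced_annihilator_of_twoSheet_sets Ju Jv T₁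
    (fun j v => by rw [hT₁, hPa]) (fun j v => by rw [hT₁, hPx]) c hF
  -- the embedding `ι : Q_{4m} × C_p ↪ Gal(K/ℚ)` and the normal subgroup `⟨u⟩ = ι(C_p)`
  obtain ⟨ι, hιinj, hιa, hιxa, hιu, hιq⟩ :=
    exists_injective_hom_quaternion_prod_cyclic hm hcop hA hX hXA hu hAu hXu
  have hmval : ((m : ℕ) : ZMod (2 * m)).val = m := by
    rw [ZMod.val_natCast]
    exact Nat.mod_eq_of_lt (by have := NeZero.ne m; omega)
  have hιc : ι (a m, 1) = (IsCMField.complexConj K).restrictScalars ℚ := by rw [hιa, hmval, hc]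
  have hurange : ∀ k : ℕ, u ^ k = ι (1, Multiplicative.ofAdd (k : ZMod p)) := fun k => by
    rw [hιu, ZMod.val_natCast, ← hu, pow_mod_orderOf]
  have hNι : ∀ n ∈ Subgroup.zpowers u, n ∈ Set.range ι := by
    intro n hn
    obtain ⟨k, rfl⟩ := ((isOfFinOrder_of_finite u).mem_powers_iff_mem_zpowers.mpr hn)
    exact ⟨_, (hurange k).symm⟩
  have hcN : (IsCMField.complexConj K).restrictScalars ℚ ∉ Subgroup.zpowers u := by
    intro hmem
    obtain ⟨k, hk⟩ := ((isOfFinOrder_of_finite u).mem_powers_iff_mem_zpowers.mpr hmem)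
    have hcp : ((IsCMField.complexConj K).restrictScalars ℚ) ^ p = 1 := by
      rw [← hk, ← pow_mul, mul_comm, pow_mul, ← hu, pow_orderOf_eq_one, one_pow]
    obtain ⟨r, hr⟩ := hpr.odd_of_ne_two hp2
    have hcc : ((IsCMField.complexConj K).restrictScalars ℚ) ^ 2 = 1 := by
      rw [pow_two]; exact GaloisOctic.complexConj_mul_self
    rw [hr, pow_succ, pow_mul, hcc, one_pow, one_mul] at hcp
    exact model_complexConj_ne_one (MulEquiv.refl _) rfl hcp
  have hN1 : Subgroup.zpowers u ≠ ⊥ := by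
    rw [Ne, Subgroup.zpowers_eq_bot]
    intro h1
    rw [h1, orderOf_one] at hu
    exact hpr.one_lt.ne' hu.symm
  -- `N₁ = {(1, v)} = ι⁻¹⟨u⟩`
  let emb : ZMod p ↪ QuaternionGroup m × Multiplicative (ZMod p) :=
    ⟨fun v => (1, Multiplicative.ofAdd v), fun v w h => by simpa using congrArg Prod.snd h⟩
  set N₁ : Finset (QuaternionGroup m × Multiplicative (ZMod p)) := Finset.univ.map emb with hN₁_def
  have hN₁ : ∀ n₁, n₁ ∈ N₁ ↔ ι n₁ ∈ Subgroup.zpowers u := by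
    intro n₁
    constructor
    · intro h
      obtain ⟨v, -, rfl⟩ := Finset.mem_map.mp h
      change ι (1, Multiplicative.ofAdd v) ∈ Subgroup.zpowers u
      rw [hιu]
      exact Subgroup.pow_mem _ (Subgroup.mem_zpowers u) _
    · intro h
      obtain ⟨k, hk⟩ := ((isOfFinOrder_of_finite u).mem_powers_iff_mem_zpowers.mpr h)
      change u ^ k = ι n₁ at hk
      rw [hurange] at hk
      have := hιinj hk
      exact Finset.mem_map.mpr ⟨(k : ZMod p), Finset.mem_univ _, this⟩
  have hbal₁' : ∀ x, ∑ n ∈ N₁, b₁ (x * n) = 0 := fun x => by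
    rw [hN₁_def, Finset.sum_map]
    exact hbal₁ x
  exact exists_simple_degenerate_of_subgroup_annihilator ι hιinj (a m, 1) hιc (Subgroup.zpowers u) hNι hcN hN1 N₁ hN₁
    T₁ (fun x => by rw [hT₁, hT₁]; exact hcm₁ x) (fun v hv => by
      obtain ⟨w, hw⟩ := hprim₁ v hv; exact ⟨w, by rwa [hT₁, hT₁]⟩) b₁ hanti₁ hann₁ hb₁ hbal₁'

end Summit.HodgeConjecture.CorCM.GaloisModels

end
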